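import Mathlib.RingTheory.DedekindDomain.AdicValuation
import Mathlib.NumberTheory.NumberField.Basic
import HarnessLib

/-!
# K2 ∕ E5 «TamagawaUnitary» — (32) CERT §6, organ-let for (E6): an integral ideal with PRESCRIBED SUPPORT and multiplicities

Cell `hodgecm-mathlib` (Track B «K2-LIT»), engine E5, item h413 = `stmt-HodgeConjecture-24833` (`--supports … --as helper`); (32) CERT §6 CAPSTONE LEAD K2E5-p03 (g2).
The (E6) assembly of the Euler comparison datum ‹ZE› (★ R1 `K2E5QuatZetaComparisonOfEulerData`) must choose, AFTER the finite bad set `S` of the pair `(h₁, h₂)` is fixed,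
a level `𝔫 ≠ 0` of the comparison test functions (★ (Z1) `K2E5QuatComparisonTestFunction`, K2E5-p16 (g2)) with `supp 𝔫 = S` and multiplicity at least the saturation
thresholds `k v` of the bad-place organ (E3) at every `v ∈ S`.  This file supplies that ideal: `𝔫 := ∏_{v ∈ S} v^{k v + 1}`.

* `exists_ideal_support_eq` — `∃ 𝔫 ≠ 0, (∀ v ∈ S, v^{k v} ∣ 𝔫) ∧ (∀ v, v ∣ 𝔫 → v ∈ S)`, for any Dedekind domain.

HONEST LABEL: HC_CM is proved only modulo the 7 printed citations (2 remaining named inputs: hLiu418 = stmt-HodgeConjecture-24832,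
h413 = stmt-HodgeConjecture-24833) until rung 0 closes; count-neutral helper.
-/

set_option autoImplicit false
set_option linter.dupNamespace false

namespace Summit.HodgeConjecture.HodgeConjecture.Cruxes.H413.K2E5IdealPrescribedSupport

open IsDedekindDomain

variable {R : Type*} [CommRing R] [IsDedekindDomain R]

/-- A height-one prime dividing another height-one prime's power IS that prime. [folklore] -/
theorem eq_of_asIdeal_dvd_pow {v w : HeightOneSpectrum R} {n : ℕ} (h : v.asIdeal ∣ w.asIdeal ^ n) : v = w := by
  have h1 : v.asIdeal ∣ w.asIdeal := v.prime.dvd_of_dvd_pow h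
  have hle : w.asIdeal ≤ v.asIdeal := Ideal.le_of_dvd h1
  have heq : w.asIdeal = v.asIdeal := w.isMaximal.eq_of_le v.isPrime.ne_top hle
  exact HeightOneSpectrum.ext heq.symm

/-- **AN IDEAL WITH PRESCRIBED SUPPORT AND MULTIPLICITIES**: for a finite set `S` of height-one primes of a Dedekind domain and exponents `k`, the ideal
`𝔫 := ∏_{v ∈ S} v^{k v + 1}` is non-zero, divisible by `v^{k v}` for `v ∈ S`, and divisible by NO prime outside `S`. [folklore] -/
theorem exists_ideal_support_eq (S : Finset (HeightOneSpectrum R)) (k : HeightOneSpectrum R → ℕ) :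
    ∃ 𝔫 : Ideal R, 𝔫 ≠ 0 ∧ (∀ v ∈ S, v.asIdeal ^ k v ∣ 𝔫) ∧ (∀ v : HeightOneSpectrum R, v.asIdeal ∣ 𝔫 → v ∈ S) := by
  classical
  refine ⟨∏ v ∈ S, v.asIdeal ^ (k v + 1), ?_, ?_, ?_⟩
  · exact Finset.prod_ne_zero_iff.2 fun v _ => pow_ne_zero _ v.ne_bot
  · intro v hv
    exact (pow_dvd_pow _ (Nat.le_succ _)).trans (Finset.dvd_prod_of_mem (fun w => w.asIdeal ^ (k w + 1)) hv)
  · intro v hv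
    obtain ⟨w, hw, hvw⟩ := (v.prime.dvd_finsetProd_iff _).1 hv
    rw [eq_of_asIdeal_dvd_pow hvw]
    exact hw

/-- The same with the support clause read as «`v ∉ S ⇒ v ∤ 𝔫`». [folklore] -/
theorem exists_ideal_support_eq' (S : Finset (HeightOneSpectrum R)) (k : HeightOneSpectrum R → ℕ) :
    ∃ 𝔫 : Ideal R, 𝔫 ≠ 0 ∧ (∀ v ∈ S, v.asIdeal ^ k v ∣ 𝔫) ∧ (∀ v : HeightOneSpectrum R, v ∉ S → ¬ v.asIdeal ∣ 𝔫) := by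
  obtain ⟨𝔫, h0, hk, hS⟩ := exists_ideal_support_eq S k
  exact ⟨𝔫, h0, hk, fun v hv hdvd => hv (hS v hdvd)⟩

end Summit.HodgeConjecture.HodgeConjecture.Cruxes.H413.K2E5IdealPrescribedSupport
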